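import Mathlib
import Summits.ValiantsHypothesis.ValiantsHypothesis.Theorems.NewtonUnitEquationsDissociatedUniformTotalsLaw
import Summits.ValiantsHypothesis.ValiantsHypothesis.Theorems.NewtonUnitEquationsDissociatedUniformTotalsLawHexagonCount
import Summits.ValiantsHypothesis.ValiantsHypothesis.Theorems.NewtonUnitEquationsDissociatedUniformTotalsLawTriangles
import Literature.Computability.AlgebraicComplexity.NewtonPolygonTauProductBounds
import HarnessLib

/-!
# Crux `NewtonUnitEquations.DissociatedUniform` (stmt-ValiantsHypothesis-5905), `n = 3` totals law of model (Q**):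
# the typed triangle conjecture `TriangleBound C` is FALSE AS TYPED for every `C` (degenerate curves)

`…TotalsLawTriangles` typed the located class-free relaxation `TriangleBound C : ∀ q a b c, triangleCount a b c ≤ C q²`
(census `N_△ ≤ 2.9 q²` on injective configurations, NOTES-t1g7 §3), where `TriTop a b c x y z` asks for ONE weight exposing the
POINTS `a x + b y`, `b y + c z`, `a x + c z` on their pair fibres.  For CONSTANT curves every pair fibre is a single point, which is
trivially a strict top for every weight, so EVERY word is a triangle and `triangleCount = q³` (`triangleCount_const`): the typed
statement fails at `q = C + 1` (`not_triangleBound`).  CLASS: refuted-MISSTATED (degenerate case: words are counted with the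
multiplicity of their spellings; the census curves were injective with distinct pair sums).  REPAIR: count triangle words through
TIE-BROKEN top letters at generic chart times — the `triWords` of `…TotalsLawChartSamples` (one spelling per exposed point), which
still dominate `T` (`sum_card_chartTops_le_card_triWords`) and are `O(q^{5/2})` by `…TotalsLawTriangleWords.card_triWords_le`; the
repaired conjecture "`#triWords ≤ C q²`" is OPEN (located `C = 3`).  The implication `totalsLawThreeCyclic_of_triangleBound` is
therefore vacuous; `TotalsLawThree C` itself is untouched (OPEN); VP ≠ VNP is not touched.
[folklore]
-/

set_option linter.dupNamespace false -- `ValiantsHypothesis.ValiantsHypothesis` (summit = problem) in every name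

open Finset Matrix

namespace Summit.ValiantsHypothesis.ValiantsHypothesis.Theorems.NewtonUnitEquationsDissociatedUniform

namespace TotalsLaw

open Literature.Computability.AlgebraicComplexity.KPTT.PlanarMinkowski

/-- A one-point fibre has its point as a strict top for every weight. [folklore] -/
theorem isStrictTop_image_const {q : ℕ} [NeZero q] (w p : Fin 2 → ℝ) :
    IsStrictTop w (univ.image fun _ : ZMod q => p) p := by
  refine ⟨mem_image.2 ⟨0, mem_univ _, rfl⟩, fun y hy hne => ?_⟩
  obtain ⟨-, -, rfl⟩ := mem_image.1 hy
  exact absurd rfl hne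

/-- **For constant curves every word is a triangle.** [folklore] -/
theorem triTop_const {q : ℕ} [NeZero q] (p₁ p₂ p₃ : Fin 2 → ℝ) (x y z : ZMod q) :
    TriTop (fun _ : ZMod q => p₁) (fun _ => p₂) (fun _ => p₃) x y z := by
  refine ⟨0, ?_, ?_, ?_⟩
  · unfold fibreFin; exact isStrictTop_image_const 0 (p₁ + p₂)
  · unfold fibreFin; exact isStrictTop_image_const 0 (p₂ + p₃)
  · unfold fibreFin; exact isStrictTop_image_const 0 (p₁ + p₃)

/-- **`triangleCount = q³` for constant curves.** [folklore] -/
theorem triangleCount_const {q : ℕ} [NeZero q] (p₁ p₂ p₃ : Fin 2 → ℝ) :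
    triangleCount (fun _ : ZMod q => p₁) (fun _ => p₂) (fun _ => p₃) = q ^ 3 := by
  unfold triangleCount
  simp only [indic_of_true (triTop_const p₁ p₂ p₃ _ _ _), sum_const, card_univ, ZMod.card, smul_eq_mul, mul_one]
  ring

/-- **`TriangleBound C` is false for every `C`** (refuted-misstated: constant curves over `ZMod (C + 1)` have `(C+1)³ > C (C+1)²`
triangles; repair = tie-broken triangle words, see the module docstring). [folklore] -/
theorem not_triangleBound (C : ℕ) : ¬ TriangleBound C := by
  intro h
  have hC := h (C + 1) (fun _ : ZMod (C + 1) => (0 : Fin 2 → ℝ)) (fun _ => 0) (fun _ => 0)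
  rw [triangleCount_const] at hC
  have hlt : C * (C + 1) ^ 2 < (C + 1) ^ 3 := by
    rw [show (C + 1) ^ 3 = (C + 1) * (C + 1) ^ 2 by ring]
    exact Nat.mul_lt_mul_of_pos_right (Nat.lt_succ_self C) (by positivity)
  exact absurd hC (not_le.2 hlt)

/-- There is no constant for which the typed triangle bound holds. [folklore] -/
theorem not_exists_triangleBound : ¬ ∃ C, TriangleBound C := fun ⟨C, h⟩ => not_triangleBound C h

end TotalsLaw

end Summit.ValiantsHypothesis.ValiantsHypothesis.Theorems.NewtonUnitEquationsDissociatedUniform
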